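import Literature.AlgebraicGeometry.Motives.SupersingularAbelianVarietyProofs
import Literature.AlgebraicGeometry.Motives.AbelianVarietyExterior
import Mathlib.LinearAlgebra.Multilinear.Curry
import Mathlib.LinearAlgebra.Dual.Lemmas
import Mathlib.GroupTheory.Perm.Fin
import Mathlib.Algebra.Polynomial.Roots
import HarnessLib

/-!
# Products of divisor classes are Lefschetz classes; on an abelian variety, Lefschetz classes
# in degree two give Lefschetz classes in every degree

Sibling file of `Literature.AlgebraicGeometry.Motives.SupersingularAbelianVariety` (the named
fact `LenstraZarhin1993_supersingular_lefschetzClasses_eq_top`: on a supersingular abelian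
variety every cohomology class is a Lefschetz class, Lenstra–Zarhin 1993, §1, p. 179). There
`W.lefschetzClasses X r ⊆ H²ʳ(X)` is the `K`-span of the `r`-th **powers** `Dʳ` of the
`K`-combinations `D` of divisor classes, whereas Milne's Lefschetz classes (Milne 2009, §1.3) are
the elements of the `ℚ`-subalgebra generated by divisor classes, i.e. combinations of **products**
`D₁ ∪ ⋯ ∪ D_r`; the two spans agree by polarization. This file proves that, formally in the
axioms of a Weil cohomology theory (Kleiman 1968, §1.2), and deduces the exterior-algebra step of
Lenstra–Zarhin's remark: on an abelian variety whose `H²` is spanned by divisor classes, every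
`H²ʳ` is spanned by Lefschetz classes.

* `MultilinearMap.mem_of_forall_sum_pow_smul_mem`, `MultilinearMap.map_mem_span_range_diag`:
  **polarization for symmetric multilinear maps** over a field of characteristic zero — the
  values `μ(v₁, …, v_m)` of a symmetric multilinear map lie in the span of its diagonal values
  `μ(E, …, E)` (expand `μ(E + n a, …, E + n a)` in powers of `n ∈ ℕ`, extract the coefficient of
  `n¹` by a Vandermonde/polynomial-identity argument, and induct on `m` through `curryLeft`);
* `WeilCohomology.evenProd X r`: the iterated cup product `D₀ ∪ (D₁ ∪ ⋯)` of `r` degree-two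
  classes as a multilinear map `H²(X)^r → H²ʳ(X)`; it is symmetric (`evenProd_perm`, graded
  commutativity in even degrees) and `evenProd (D, …, D) = Dʳ` (`evenProd_const`);
* `WeilCohomology.evenProd_mem_lefschetzClasses`: **products of `K`-combinations of divisor
  classes are Lefschetz classes** (Milne 2009, §1.3);
* `WeilCohomology.exists_prodMap_eq_evenProd`, `AbelianVariety.exists_pow_ne_zero`,
  `WeilCohomology.lefschetzClasses_eq_top_of_algebraicClasses_one_eq_top`: on an abelian variety
  `A` (where `H•(A)` is generated by `H¹(A)`, `span_range_prodMap` of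
  `Motives/AbelianVarietyExterior`, given a degree-two class `w` with `w^{dim A} ≠ 0`, which a
  hyperplane class provides), a product of `2r` degree-one classes is a product of `r`
  degree-two classes, so **if the divisor classes span `H²(A)` then the Lefschetz classes span
  every `H²ʳ(A)`** — the step "`⋀²ʳ H¹` is spanned by products of `r` elements of `⋀² H¹`" of
  the argument recorded in `SupersingularAbelianVariety`.

## References

* [LenstraZarhin1993] H. W. Lenstra, Jr., Yu. G. Zarhin, *The Tate conjecture for almost ordinary
  abelian varieties over finite fields*, Advances in Number Theory (CNTA III), OUP 1993, §1,
  p. 179.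
* [Milne2009RationalTate] J. S. Milne, *Rational Tate classes*, Moscow Math. J. 9 (2009), §1.3.
* [Kleiman1968] S. Kleiman, *Algebraic cycles and the Weil conjectures*, Dix exposés (1968),
  §1.2, Appendix 2A.

## Design notes

* No named fact is introduced. The two definitions (`consEvenProd`, `evenProd`) mirror
  `consProd`/`prodMap` of `Motives/AbelianVarietyExterior` in even degrees.
* Symmetry of a multilinear map is kept as the explicit hypothesis
  `∀ σ v, μ (fun i ↦ v (σ i)) = μ v` rather than a new predicate.
-/

noncomputable section

universe u v

open CategoryTheory AlgebraicGeometry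

namespace Literature.AlgebraicGeometry.Motives

/-! ## Polarization for symmetric multilinear maps -/

section Polarization

variable {K : Type*} [Field K] [CharZero K] {V : Type*} [AddCommGroup V] [Module K V]
  {M : Type*} [AddCommGroup M] [Module K M]

open Polynomial in
/-- **Coefficient extraction** (Vandermonde): if `Σ_{j<N} nʲ • c_j ∈ P` for every natural
number `n`, then each `c_j ∈ P` (`j < N`) — the `K`-valued polynomial `Σ_j φ(c_j mod P) Xʲ` has
infinitely many roots for every linear functional `φ` on `M ⧸ P`. [folklore] -/
theorem MultilinearMap.mem_of_forall_sum_pow_smul_mem (P : Submodule K M) {N : ℕ} (c : ℕ → M)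
    (h : ∀ n : ℕ, ∑ j ∈ Finset.range N, ((n : K) ^ j) • c j ∈ P) {j : ℕ} (hj : j < N) :
    c j ∈ P := by
  classical
  rw [← Submodule.Quotient.mk_eq_zero, ← Module.forall_dual_apply_eq_zero_iff K]
  intro φ
  let ψ : M →ₗ[K] K := φ ∘ₗ P.mkQ
  have hψ : ∀ n : ℕ, ∑ i ∈ Finset.range N, ψ (c i) * (n : K) ^ i = 0 := by
    intro n
    have h0 : ψ (∑ i ∈ Finset.range N, ((n : K) ^ i) • c i) = 0 := by
      simp only [ψ, LinearMap.comp_apply, Submodule.mkQ_apply,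
        (Submodule.Quotient.mk_eq_zero P).2 (h n), map_zero]
    rw [map_sum] at h0
    rw [← h0]
    refine Finset.sum_congr rfl fun i _ ↦ ?_
    rw [map_smul, smul_eq_mul, mul_comm]
  let p : K[X] := ∑ i ∈ Finset.range N, C (ψ (c i)) * X ^ i
  have hp : p = 0 := by
    apply Polynomial.eq_zero_of_infinite_isRoot
    refine Set.Infinite.mono ?_ (Set.infinite_range_of_injective (Nat.cast_injective (R := K)))
    rintro _ ⟨n, rfl⟩
    simp only [Set.mem_setOf_eq, IsRoot.def, p, eval_finsetSum, eval_mul, eval_C, eval_pow,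
      eval_X]
    exact hψ n
  have hc := congrArg (fun q : K[X] ↦ q.coeff j) hp
  simp only [p, finsetSum_coeff, coeff_C_mul_X_pow, coeff_zero, Finset.sum_ite_eq,
    Finset.mem_range, if_pos hj] at hc
  exact hc

/-- **Polarization for symmetric multilinear maps.** Over a field of characteristic zero, every
value `μ(v₀, …, v_{m-1})` of a symmetric `m`-linear map lies in the `K`-span of the diagonal
values `μ(E, …, E)`. Proof: `μ(E + n a, …, E + n a) = Σ_j nʲ c_j` with
`c₁ = m • μ(a, E, …, E)` (symmetry), so `μ(a, E, …, E)` is in the span for all `a`, `E`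
(`mem_of_forall_sum_pow_smul_mem`); then induct on `m`, applying the statement to the symmetric
map `μ(a, ·)`. [folklore] -/
theorem MultilinearMap.map_mem_span_range_diag :
    ∀ (m : ℕ) (μ : MultilinearMap K (fun _ : Fin m ↦ V) M)
      (_hμ : ∀ (σ : Equiv.Perm (Fin m)) (v : Fin m → V), μ (fun i ↦ v (σ i)) = μ v)
      (v : Fin m → V), μ v ∈ Submodule.span K (Set.range fun E : V ↦ μ fun _ ↦ E) := by
  classical
  intro m
  induction m with
  | zero =>
    intro μ _ v
    have hv : v = fun _ ↦ (0 : V) := funext fun i ↦ i.elim0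
    rw [hv]
    exact Submodule.subset_span ⟨0, rfl⟩
  | succ m ih =>
    intro μ hμ v
    set P := Submodule.span K (Set.range fun E : V ↦ μ fun _ ↦ E) with hP
    -- Step A: `μ(a, E, …, E) ∈ P`
    have stepA : ∀ a E : V, μ (Fin.cons a fun _ ↦ E) ∈ P := by
      intro a E
      -- the mixed values and their sums over subsets of fixed size
      let b : Finset (Fin (m + 1)) → M := fun s ↦ μ (s.piecewise (fun _ ↦ a) fun _ ↦ E)
      have hmem : ∀ n : ℕ, ∑ j ∈ Finset.range (m + 1 + 1),
          ((n : K) ^ j) • (∑ s ∈ Finset.powersetCard j Finset.univ, b s) ∈ P := by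
        intro n
        have hgen : μ (fun _ ↦ (n : K) • a + E) ∈ P := Submodule.subset_span ⟨(n : K) • a + E, rfl⟩
        have hexp : μ (fun _ ↦ (n : K) • a + E) =
            ∑ s : Finset (Fin (m + 1)), ((n : K) ^ s.card) • b s := by
          have h1 : (fun _ : Fin (m + 1) ↦ (n : K) • a + E) =
              (fun _ ↦ (n : K) • a) + fun _ ↦ E := rfl
          rw [h1, MultilinearMap.map_add_univ]
          refine Finset.sum_congr rfl fun s _ ↦ ?_
          have h2 : s.piecewise (fun _ : Fin (m + 1) ↦ (n : K) • a) (fun _ ↦ E) =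
              s.piecewise (fun i ↦ (n : K) • s.piecewise (fun _ ↦ a) (fun _ ↦ E) i)
                (s.piecewise (fun _ ↦ a) fun _ ↦ E) := by
            ext i
            by_cases hi : i ∈ s <;> simp [hi]
          rw [h2, MultilinearMap.map_piecewise_smul, Finset.prod_const]
        have hregroup : ∑ s : Finset (Fin (m + 1)), ((n : K) ^ s.card) • b s =
            ∑ j ∈ Finset.range (m + 1 + 1), ((n : K) ^ j) •
              ∑ s ∈ Finset.powersetCard j Finset.univ, b s := by
          rw [← Finset.powerset_univ, Finset.powerset_card_disjiUnion, Finset.sum_disjiUnion,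
            Finset.card_univ, Fintype.card_fin]
          refine Finset.sum_congr rfl fun j _ ↦ ?_
          rw [Finset.smul_sum]
          refine Finset.sum_congr rfl fun s hs ↦ ?_
          rw [(Finset.mem_powersetCard.mp hs).2]
        rw [hexp, hregroup] at hgen
        exact hgen
      have hc1 := MultilinearMap.mem_of_forall_sum_pow_smul_mem P _ hmem
        (j := 1) (by omega)
      -- `c₁ = Σ_i μ(E, …, a at i, …, E) = (m + 1) • μ(a, E, …, E)`
      have hupd0 : Function.update (fun _ : Fin (m + 1) ↦ E) 0 a = Fin.cons a fun _ ↦ E := by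
        ext i
        refine Fin.cases ?_ (fun j ↦ ?_) i
        · simp
        · rw [Function.update_of_ne (Fin.succ_ne_zero j), Fin.cons_succ]
      have hsingle : ∀ i : Fin (m + 1),
          b {i} = μ (Fin.cons a fun _ ↦ E) := by
        intro i
        simp only [b]
        rw [Finset.piecewise_singleton, ← hupd0]
        have hcomp : (fun x ↦ Function.update (fun _ : Fin (m + 1) ↦ E) 0 a (Equiv.swap 0 i x)) =
            Function.update (fun _ : Fin (m + 1) ↦ E) i a := by
          change Function.update (fun _ : Fin (m + 1) ↦ E) 0 a ∘ Equiv.swap 0 i = _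
          rw [Function.update_comp_equiv]
          congr 1
        rw [← hcomp, hμ]
      have hc1' : ∑ s ∈ Finset.powersetCard 1 (Finset.univ : Finset (Fin (m + 1))), b s =
          ((m + 1 : ℕ) : K) • μ (Fin.cons a fun _ ↦ E) := by
        rw [Finset.powersetCard_one, Finset.sum_map]
        simp only [Function.Embedding.coeFn_mk, hsingle, Finset.sum_const, Finset.card_univ,
          Fintype.card_fin]
        rw [Nat.cast_smul_eq_nsmul]
      rw [hc1'] at hc1
      have hne : ((m + 1 : ℕ) : K) ≠ 0 := Nat.cast_ne_zero.mpr (Nat.succ_ne_zero m)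
      have h' := P.smul_mem ((m + 1 : ℕ) : K)⁻¹ hc1
      rwa [smul_smul, inv_mul_cancel₀ hne, one_smul] at h'
    -- Step B: induct through `curryLeft`
    have hsymm : ∀ (σ : Equiv.Perm (Fin m)) (w : Fin m → V),
        μ.curryLeft (v 0) (fun i ↦ w (σ i)) = μ.curryLeft (v 0) w := by
      intro σ w
      rw [MultilinearMap.curryLeft_apply, MultilinearMap.curryLeft_apply]
      have hcons : (Fin.cons (v 0) (fun i ↦ w (σ i)) : Fin (m + 1) → V) =
          fun i ↦ (Fin.cons (v 0) w : Fin (m + 1) → V)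
            (Equiv.Perm.decomposeFin.symm (0, σ) i) := by
        ext i
        refine Fin.cases ?_ (fun j ↦ ?_) i
        · rw [Equiv.Perm.decomposeFin_symm_apply_zero, Fin.cons_zero, Fin.cons_zero]
        · rw [Equiv.Perm.decomposeFin_symm_apply_succ, Equiv.swap_self, Equiv.refl_apply,
            Fin.cons_succ, Fin.cons_succ]
      rw [hcons, hμ]
    have hv : μ v = μ.curryLeft (v 0) (Fin.tail v) := by
      rw [MultilinearMap.curryLeft_apply, Fin.cons_self_tail]
    rw [hv]
    refine (Submodule.span_le.mpr ?_) (ih (μ.curryLeft (v 0)) hsymm (Fin.tail v))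
    rintro _ ⟨E, rfl⟩
    exact stepA (v 0) E

end Polarization

/-! ## Iterated cup products of degree-two classes -/

namespace WeilCohomology

variable {k : Type u} [Field k] {K : Type v} [Field K] [CharZero K] (W : WeilCohomology k K)

section EvenProd

variable (X : SchemeOver k)

/-- Left multiplication by a degree-two class composed with a multilinear map, linearly in the
class (the even-degree analogue of `consProd`). [folklore] -/
def consEvenProd (r : ℕ) (f : MultilinearMap K (fun _ : Fin r ↦ W.obj X 2) (W.obj X (2 * r))) :
    W.obj X 2 →ₗ[K] MultilinearMap K (fun _ : Fin r ↦ W.obj X 2) (W.obj X (2 * (r + 1))) where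
  toFun D := (W.cup (show 2 + 2 * r = 2 * (r + 1) by omega) D).compMultilinearMap f
  map_add' D D' := by ext u; simp
  map_smul' c D := by ext u; simp

/-- The **iterated cup product of degree-two classes**
`D₀ ∪ (D₁ ∪ (⋯ ∪ (D_{r-1} ∪ 1)))`, as a multilinear map `H²(X)^r → H²ʳ(X)` (the products of
divisor classes generating Milne's algebra of Lefschetz classes, Milne 2009, §1.3).
[cite: Milne2009RationalTate, §1.3] -/
def evenProd : (r : ℕ) → MultilinearMap K (fun _ : Fin r ↦ W.obj X 2) (W.obj X (2 * r))
  | 0 => MultilinearMap.constOfIsEmpty K _ (W.one X)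
  | r + 1 => LinearMap.uncurryLeft (W.consEvenProd X r (evenProd r))

/-- `evenProd 0 = 1`. [folklore] -/
@[simp]
lemma evenProd_zero (D : Fin 0 → W.obj X 2) : W.evenProd X 0 D = W.one X := rfl

/-- `evenProd (r+1) D = D₀ ∪ evenProd r (tail D)`. [folklore] -/
lemma evenProd_succ (r : ℕ) (D : Fin (r + 1) → W.obj X 2) :
    W.evenProd X (r + 1) D =
      W.cup (show 2 + 2 * r = 2 * (r + 1) by omega) (D 0) (W.evenProd X r (Fin.tail D)) := rfl

variable {X} {n : ℕ}

/-- **Degree-two classes are central**: `D ∪ y = y ∪ D` for `D ∈ H²(X)`, `y ∈ Hʲ(X)` (the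
sign `(-1)^{2j}` of graded commutativity is `+1`; Kleiman 1968, §1.2). [cite: Kleiman1968, §1.2] -/
theorem cup_comm_two (hX : IsSmoothProjective n X) {j m : ℕ} (h : 2 + j = m) (h' : j + 2 = m)
    (D : W.obj X 2) (y : W.obj X j) : W.cup h D y = W.cup h' y D := by
  rw [W.cup_comm hX h h' D y, Int.negOnePow_even _ (Int.even_mul.mpr (Or.inl (by norm_num))),
    Units.val_one, one_smul]

/-- **The diagonal of `evenProd` is the power**: `evenProd r (D, …, D) = Dʳ` (graded
commutativity in even degrees moves each new factor to the right). [folklore] -/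
theorem evenProd_const (hX : IsSmoothProjective n X) (r : ℕ) (D : W.obj X 2) :
    W.evenProd X r (fun _ ↦ D) = W.pow X D r := by
  induction r with
  | zero => rfl
  | succ r ih =>
    rw [evenProd_succ, W.pow_succ]
    change W.cup _ D (W.evenProd X r fun _ ↦ D) = _
    rw [ih]
    exact W.cup_comm_two hX _ rfl D _

/-- Swapping the first two factors does not change the iterated product:
`D₀ ∪ (D₁ ∪ y) = D₁ ∪ (D₀ ∪ y)` (associativity and commutativity in even degrees). [folklore] -/
theorem cup_cup_swap (hX : IsSmoothProjective n X) {r : ℕ} (D₀ D₁ : W.obj X 2)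
    (y : W.obj X (2 * r)) :
    W.cup (show 2 + 2 * (r + 1) = 2 * (r + 1 + 1) by omega) D₀
        (W.cup (show 2 + 2 * r = 2 * (r + 1) by omega) D₁ y) =
      W.cup (show 2 + 2 * (r + 1) = 2 * (r + 1 + 1) by omega) D₁
        (W.cup (show 2 + 2 * r = 2 * (r + 1) by omega) D₀ y) := by
  rw [← W.cup_assoc hX (rfl : 2 + 2 = 4) (show 2 + 2 * r = 2 * (r + 1) by omega)
      (show 4 + 2 * r = 2 * (r + 1 + 1) by omega)
      (show 2 + 2 * (r + 1) = 2 * (r + 1 + 1) by omega),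
    W.cup_comm_two hX (rfl : 2 + 2 = 4) rfl D₀ D₁,
    W.cup_assoc hX (rfl : 2 + 2 = 4) (show 2 + 2 * r = 2 * (r + 1) by omega)
      (show 4 + 2 * r = 2 * (r + 1 + 1) by omega)
      (show 2 + 2 * (r + 1) = 2 * (r + 1 + 1) by omega)]

/-- `evenProd` is invariant under the transposition of the first two factors. [folklore] -/
theorem evenProd_swap_zero_one (hX : IsSmoothProjective n X) (r : ℕ)
    (D : Fin (r + 1 + 1) → W.obj X 2) :
    W.evenProd X (r + 1 + 1) (fun x ↦ D (Equiv.swap 0 1 x)) = W.evenProd X (r + 1 + 1) D := by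
  rw [evenProd_succ, evenProd_succ, evenProd_succ W X (r + 1) D, evenProd_succ W X r (Fin.tail D)]
  have htail : Fin.tail (Fin.tail fun x ↦ D (Equiv.swap 0 1 x)) = Fin.tail (Fin.tail D) := by
    funext x
    simp only [Fin.tail]
    rw [Equiv.swap_apply_of_ne_of_ne (Fin.succ_ne_zero _) fun h ↦
      Fin.succ_ne_zero x (Fin.succ_injective _ (h.trans Fin.succ_zero_eq_one.symm))]
  rw [htail]
  simp only [Fin.tail, Fin.succ_zero_eq_one, Equiv.swap_apply_left, Equiv.swap_apply_right]
  exact W.cup_cup_swap hX (D 1) (D 0) _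

/-- `evenProd` is invariant under the adjacent transpositions `(i, i+1)`. [folklore] -/
theorem evenProd_swap_castSucc_succ (hX : IsSmoothProjective n X) :
    ∀ (r : ℕ) (i : Fin (r + 1)) (D : Fin (r + 1 + 1) → W.obj X 2),
      W.evenProd X (r + 1 + 1) (fun x ↦ D (Equiv.swap i.castSucc i.succ x)) =
        W.evenProd X (r + 1 + 1) D := by
  intro r
  induction r with
  | zero =>
    intro i D
    obtain rfl : i = 0 := Fin.eq_zero i
    simp only [Fin.castSucc_zero, Fin.succ_zero_eq_one]
    exact W.evenProd_swap_zero_one hX 0 D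
  | succ r ih =>
    intro i D
    cases i using Fin.cases with
    | zero =>
      simp only [Fin.castSucc_zero, Fin.succ_zero_eq_one]
      exact W.evenProd_swap_zero_one hX (r + 1) D
    | succ i =>
      have h0 : Equiv.swap i.succ.castSucc i.succ.succ 0 = 0 :=
        Equiv.swap_apply_of_ne_of_ne
          (fun h ↦ Fin.succ_ne_zero i.castSucc (by rw [Fin.succ_castSucc]; exact h.symm))
          (Fin.succ_ne_zero _).symm
      have htail : (Fin.tail fun x ↦ D (Equiv.swap i.succ.castSucc i.succ.succ x)) =
          fun x ↦ Fin.tail D (Equiv.swap i.castSucc i.succ x) := by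
        funext x
        simp only [Fin.tail]
        rw [← Fin.succ_castSucc, (Fin.succ_injective _).swap_apply]
      rw [evenProd_succ, evenProd_succ W X (r + 1 + 1) D, htail, ih i (Fin.tail D)]
      simp only [h0]

/-- **`evenProd` is symmetric**: the iterated cup product of degree-two classes does not depend
on the order of the factors (the adjacent transpositions generate the symmetric group,
`Equiv.Perm.mclosure_swap_castSucc_succ`). [cite: Kleiman1968, §1.2] -/
theorem evenProd_perm (hX : IsSmoothProjective n X) (r : ℕ) (σ : Equiv.Perm (Fin r))
    (D : Fin r → W.obj X 2) : W.evenProd X r (fun x ↦ D (σ x)) = W.evenProd X r D := by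
  cases r with
  | zero => rfl
  | succ r =>
    have hσ : σ ∈ Submonoid.closure (Set.range fun i : Fin r ↦ Equiv.swap i.castSucc i.succ) := by
      rw [Equiv.Perm.mclosure_swap_castSucc_succ]
      exact Submonoid.mem_top σ
    induction hσ using Submonoid.closure_induction generalizing D with
    | mem τ hτ =>
      obtain ⟨i, rfl⟩ := hτ
      cases r with
      | zero => exact i.elim0
      | succ r => exact W.evenProd_swap_castSucc_succ hX r i D
    | one => rfl
    | mul τ τ' _ _ h h' =>
      calc W.evenProd X (r + 1) (fun x ↦ D ((τ * τ') x))
          = W.evenProd X (r + 1) (fun x ↦ (fun y ↦ D (τ y)) (τ' x)) := rfl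
        _ = W.evenProd X (r + 1) (fun y ↦ D (τ y)) := h' (fun y ↦ D (τ y))
        _ = W.evenProd X (r + 1) D := h D

/-- **Products of `K`-combinations of divisor classes are Lefschetz classes**: for
`D₀, …, D_{r-1}` in the `K`-span of the divisor classes, `D₀ ∪ ⋯ ∪ D_{r-1}` lies in the
`K`-span of the `r`-th powers `Dʳ` of such classes (polarization of the symmetric multilinear
map `evenProd`; Milne 2009, §1.3: the Lefschetz classes form the `ℚ`-algebra generated by
divisor classes). [cite: Milne2009RationalTate, §1.3] -/
theorem evenProd_mem_lefschetzClasses (hX : IsSmoothProjective n X) (r : ℕ)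
    (D : Fin r → W.obj X 2) (hD : ∀ i, D i ∈ W.algebraicClasses X 1) :
    W.evenProd X r D ∈ W.lefschetzClasses X r := by
  let L := W.algebraicClasses X 1
  let μ : MultilinearMap K (fun _ : Fin r ↦ L) (W.obj X (2 * r)) :=
    (W.evenProd X r).compLinearMap fun _ ↦ L.subtype
  have hμ : ∀ (σ : Equiv.Perm (Fin r)) (v : Fin r → L), μ (fun i ↦ v (σ i)) = μ v := by
    intro σ v
    simp only [μ, MultilinearMap.compLinearMap_apply, Submodule.subtype_apply]
    exact W.evenProd_perm hX r σ fun i ↦ (v i : W.obj X 2)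
  have hmem := MultilinearMap.map_mem_span_range_diag r μ hμ fun i ↦ ⟨D i, hD i⟩
  have hval : μ (fun i ↦ ⟨D i, hD i⟩) = W.evenProd X r D := by
    simp only [μ, MultilinearMap.compLinearMap_apply, Submodule.subtype_apply]
  rw [hval] at hmem
  refine (Submodule.span_le.mpr ?_) hmem
  rintro _ ⟨E, rfl⟩
  simp only [μ, MultilinearMap.compLinearMap_apply, Submodule.subtype_apply, SetLike.mem_coe]
  rw [W.evenProd_const hX r (E : W.obj X 2)]
  exact W.pow_mem_lefschetzClasses X E.2 r

/-- A smooth projective variety of dimension `n` carries a degree-two class `w` with `wⁿ ≠ 0`: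
`1 ≠ 0` for `n = 0`, and a hyperplane class `η` (with `tr(ηⁿ) = deg X > 0`) for `n ≥ 1`
(Kleiman 1968, §1.2 (C), §1.4). [cite: Kleiman1968, §1.2 (C)] -/
theorem exists_pow_ne_zero (hX : IsSmoothProjective n X) : ∃ w : W.obj X 2, W.pow X w n ≠ 0 := by
  rcases Nat.eq_zero_or_pos n with rfl | hn
  · exact ⟨0, by rw [W.pow_zero]; exact W.unit_ne_zero hX⟩
  · obtain ⟨η, hη⟩ := W.isHyperplaneClass_nonempty hX hn
    obtain ⟨d, hd, htr⟩ := W.trace_pow_of_isHyperplaneClass hX η hη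
    refine ⟨η, fun h ↦ ?_⟩
    rw [h, map_zero] at htr
    exact (Nat.cast_ne_zero.mpr hd.ne') htr.symm

end EvenProd

/-! ## Abelian varieties -/

section AbelianVariety

open scoped MonObj

variable {g : ℕ} (A : AbelianVariety k)

/-- **A product of `2r` degree-one classes is a product of `r` degree-two classes**:
`m_{2r}(u) = (u₀ ∪ u₁) ∪ ((u₂ ∪ u₃) ∪ ⋯)` (associativity of the cup product).
[cite: Kleiman1968, Appendix 2A] -/
theorem exists_prodMap_eq_evenProd (hA : IsSmoothProjective g A.X) :
    ∀ (r : ℕ) (u : Fin (2 * r) → W.obj A.X 1),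
      ∃ D : Fin r → W.obj A.X 2, W.prodMap A (2 * r) u = W.evenProd A.X r D := by
  intro r
  induction r with
  | zero => intro u; exact ⟨Fin.elim0, rfl⟩
  | succ r ih =>
    intro u
    obtain ⟨D, hD⟩ := ih (Fin.tail (Fin.tail (u : Fin (2 * r + 1 + 1) → W.obj A.X 1)))
    refine ⟨Fin.cons (W.cup (rfl : 1 + 1 = 2) (u 0) (u 1)) D, ?_⟩
    change W.prodMap A (2 * r + 1 + 1) u = _
    rw [W.prodMap_succ, W.prodMap_succ, evenProd_succ, Fin.cons_zero, Fin.tail_cons, ← hD]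
    exact (W.cup_assoc hA (rfl : 1 + 1 = 2) (Nat.add_comm 1 (2 * r))
      (show 2 + 2 * r = 2 * (r + 1) by omega) (Nat.add_comm 1 (2 * r + 1)) (u 0) (u 1) _).symm

/-- **On an abelian variety, if the divisor classes span `H²` then the Lefschetz classes span
every `H²ʳ`**: `H²ʳ(A)` is spanned by products of `2r` degree-one classes
(`span_range_prodMap`: `H•(A) = ⋀• H¹(A)` for every Weil cohomology theory), i.e. by products
of `r` degree-two classes, which are products of `K`-combinations of divisor classes by
hypothesis and hence Lefschetz classes (`evenProd_mem_lefschetzClasses`). This is the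
exterior-algebra step of Lenstra–Zarhin's remark (1993, §1, p. 179) for a supersingular abelian
variety, valid for every abelian variety whose `H²` consists of divisor classes.
[cite: LenstraZarhin1993, §1 p. 179] -/
theorem lefschetzClasses_eq_top_of_algebraicClasses_one_eq_top
    (h1 : W.algebraicClasses A.X 1 = ⊤) (r : ℕ) : W.lefschetzClasses A.X r = ⊤ := by
  have hA : IsSmoothProjective A.dim A.X := AbelianVariety.isSmoothProjective_holds
  obtain ⟨w, hw⟩ := W.exists_pow_ne_zero hA
  rw [eq_top_iff, ← W.span_range_prodMap A hA hw (2 * r), Submodule.span_le]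
  rintro _ ⟨u, rfl⟩
  obtain ⟨D, hD⟩ := W.exists_prodMap_eq_evenProd A hA r u
  rw [SetLike.mem_coe, hD]
  exact W.evenProd_mem_lefschetzClasses hA r D fun i ↦ by rw [h1]; trivial

/-- The same with the hypothesis in Lefschetz form: **if `H²(A)` consists of Lefschetz classes,
so does every `H²ʳ(A)`** (`lefschetzClasses_one_eq`: in degree two the Lefschetz classes are the
`K`-span of the divisor classes). [cite: LenstraZarhin1993, §1 p. 179] -/
theorem lefschetzClasses_eq_top_of_lefschetzClasses_one_eq_top
    (h1 : W.lefschetzClasses A.X 1 = ⊤) (r : ℕ) : W.lefschetzClasses A.X r = ⊤ :=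
  W.lefschetzClasses_eq_top_of_algebraicClasses_one_eq_top A
    (by rwa [W.lefschetzClasses_one_eq AbelianVariety.isSmoothProjective_holds] at h1) r

end AbelianVariety


end WeilCohomology

end Literature.AlgebraicGeometry.Motives

end
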